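import Summits.QuantumFields.BalabanUV.T4Continuum.Spine.NE1p.DressedStabilityOfSuppliedSliceWinSchedules
import Summits.QuantumFields.BalabanUV.T4Continuum.Spine.NE1p.DressedBirthRStepAnchored

/-!
# T⁴ programme, spine estimate NE1′ (node O3b/H2) — END-ALL-slice-win ∘ SUPPLIERS THROUGH THE ℝ-STEP SEAM: THE TERMINAL FACE WITH
# L-B READ OFF THE CONSUMER ROW'S OWN DATUM `RStep` (swarm item «S3k.1» of `t4/formal/NE1p/LEAVES.md`, typer R-T51 (iii) «optional
# S3k.1 (leaf-02-g2)»; INTENT HOME/CLAIMS.log after l.10895)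

Cell `pub-balaban`, sub-cell `t4`, BINDER-OWNERS row NE1′ (owner lineage t4-ne1p-p1; root `Spine/NE1p/DressedRoot.lean` p211416);
swarm unit `b2b-balaban-t4-ne1p-formalise-leaf-02` (gen 2); tree target `Summits/QuantumFields/BalabanUV/T4Continuum/Spine/NE1p/`;
ADDITIVE — imports leaf-09-g2's TERMINAL FACE `Spine/NE1p/DressedStabilityOfSuppliedSliceWinSchedules` (row S3k p214938: END-ALL-slice-win ∘
suppliers, live-family birth door; through it S3h-2 p214712, S3i p214477, rows S4 ∕ S5b ∕ S8) and this seat's `Spine/NE1p/DressedBirthRStepAnchored`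
(row S5e p214587: `hbirth_of_rstep_cell`) ONLY; modifies nothing.  Sibling over the ratio face: S3j `DressedStabilityOfRStepSchedules` p214839.

WHAT THIS FILE DOES.  Row S3k reads leaf L-B through the LIVE-FAMILY door (absorbed families `Sabs a K` posited, «strictly older»
`holder` and «among the live families» `hsub` as dictionary, `AbsorbsFrom … Sabs …`).  This sibling reads L-B off row O3.E-iii-c's OWN
datum — ONE `Rs a K : T4PreservedUnderR.RStep (𝒯.B a K)` per run parameter and cutoff (absorbed families `absorbs`, strictly older by
`absorbs_lt`, felt at the renormalised component `comp` by `absorbs_felt`, at most `vR` cubes by `CompVol vR`) — through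
`hbirth_of_rstep_cell` (S5 §3 `hbirth_of_rstep` BY NAME, absorbed count DERIVED from the anchoring); L-C and F-8 as in S3k
(`count_of_anchoring_cell`, `hlin_budgetGate_of_lin_le_sSup`).  S3h-2's `dressedStabilityWith_swin_of_schedules` ∕
`dressedBudget_swin_of_schedules` BY NAME:
* §1 the binders once — S3k's list VERBATIM with {`holder`, `hsub`, `habs`} ↦ {`Rs`, `hcv : (Rs a K).CompVol vR`,
  `hpre : PreBelowEnv (Rs a K) (4c_δ∕r) ρ (budgetGate …)` (pre-ℝ sizes below the transported envelope under the dressed history),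
  `hlaw : AbsorbLaw (Rs a K) (4c_δ∕r) (β a K) A` («budgets add», from `RStep.Absorbs A` by `absorbLaw_of_absorbs`)}.
* §2 **`dressedStabilityWith_of_rstepSliceWinSchedules`**, **`dressedStability_of_rstepSliceWinSchedules : DressedStability 𝒯`**, ROOT-B
  **`dressedBudget_of_rstepSliceWinSchedules : DressedBudget 𝒯 wt`** — headers carry S3k's `hcm`∕`hδfwk`∕`hvN₀`∕`hA` and the fan-out pair
  at the DERIVED absorbed multiplicity `vR·mB` (`fanout A (vR·mB) ρ′ < 1`, `absorbAmplitude β₀ A (vR·mB) ρ′ ≤ A₀`).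
BINDER DIFF vs S3k (mechanical): −{`holder`, `hsub`, `habs`} +{`Rs`, `hcv`, `hpre`, `hlaw`}; header pair at `vR·mB` instead of `N₀`;
everything else VERBATIM; conclusions literal.

HONEST FRAMING.  A COMPOSITION FACE: 0 estimates, 0 new hypothesis shapes, NO `def … : Prop`, every wall binder displayed verbatim as
S3h-2 ∕ S3k display it.  Headline (c4): «NE1′ (all cutoffs, all run parameters) ⇐ EXACTLY the displayed WALL binders ∀ (a,K) — (w1)
`hsl` on cutoff-free windows, (w2-act) `hB`∕`hE`∕`hs₀`, `hcm`, (I4′) `hδf`∕`hδfwk`∕`hpairx`∕`hdefwk`∕`hrate`, (w5) `hreg` + the seam `hpre`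
— + anchoring ∕ ℝ-step absorption ∕ booking-convention DATA + the located scalars once + ratio-bounded `WindowScheduleModWin`
schedules» — NOT «NE1′ proved»: the walls are asserted for Bałaban's densities NOWHERE; `CompVol vR` and `hvol … ≤ v` with ONE `vR`,
`v` before `∀ a K` are the located instantiation demands of caveat k1 ∕ R4 (K-free for COLLARED components; not asserted for
Bałaban's large-field components).  0 binders instantiated on Bałaban's densities; spine PROVED 0∕9.  Rung (B)+1 on ONE finite
four-torus — NOT infinite volume, NOT a mass gap, NOT OS on ℝ⁴, NOT the Clay problem.  [folklore] kernel glue, 0 sorry, 0 citations.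
HONEST DEPENDENCY: continuum YM on T⁴ ⇐ BetaPertH ∧ nine spine estimates (0/9 proved); BetaPertH ⇐ (D1) ∧ (D4) ∧ CAP+tail; G-an2-4
gates asym, D1 and NE2/3/4.
-/

noncomputable section

namespace Summit.QuantumFields.BalabanUV.T4Continuum.NE1p.DressedStabilityOfRStepSliceWinSchedules

open MeasureTheory Set Metric Finset
open scoped BigOperators
open Literature.MathematicalPhysics.QuantumFieldTheory.Balaban1983to89
open Literature.MathematicalPhysics.QuantumFieldTheory.Balaban1983to89.T4TermFormat
open Literature.MathematicalPhysics.QuantumFieldTheory.Balaban1983to89.T4FeltGeometry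
open Literature.MathematicalPhysics.QuantumFieldTheory.Balaban1983to89.T4GatedBooking
open Literature.MathematicalPhysics.QuantumFieldTheory.Balaban1983to89.T4TrajectoryComparison
open Literature.MathematicalPhysics.QuantumFieldTheory.Balaban1983to89.T4TrajectoryModulus
open Literature.MathematicalPhysics.QuantumFieldTheory.Balaban1983to89.T4PreservedUnderR (RStep)
open T4BirthChartTransport (GaugeInvariant BirthSlice RelGauge)
open T4BlockTransport (Fld NDir latMove latN)
open T4TrajectoryDensity
open Summit.QuantumFields.BalabanUV.T4Continuum.T4TrajectoryDensityDressed
open Summit.QuantumFields.BalabanUV.T4Continuum.NE1p.DressedRoot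
open Summit.QuantumFields.BalabanUV.T4Continuum.NE1p.DressedWindowScheduleWin
open Summit.QuantumFields.BalabanUV.T4Continuum.NE1p.DressedWindowScheduleModWin
open Summit.QuantumFields.BalabanUV.T4Continuum.NE1p.DressedUniformConstants
open Summit.QuantumFields.BalabanUV.T4Continuum.NE1p.DressedTransportUniformWin
open Summit.QuantumFields.BalabanUV.T4Continuum.NE1p.DressedStabilityOfSliceWinSchedules
open Summit.QuantumFields.BalabanUV.T4Continuum.NE1p.DressedStabilityOfSuppliedSchedules
open Summit.QuantumFields.BalabanUV.T4Continuum.NE1p.DressedAbsorptionWindow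
open Summit.QuantumFields.BalabanUV.T4Continuum.NE1p.DressedAttainment
open Summit.QuantumFields.BalabanUV.T4Continuum.NE1p.DressedBirthRStepAnchored

/-! ## §1 The binders, once, indexed by run parameter and cutoff — S3k's list with the live-family absorption data replaced by the ℝ-step -/

section EndAll

variable {P : Type*} (𝒯 : DressedTower P)
variable {R : Type*} [NormedRing R] [NormedAlgebra ℂ R] [MeasurableSpace R] {d : ℕ}
variable {κ L cbar N₀ A₀ sbar ρ' r cδ m : ℝ} {w : P → ℕ → ℝ}
variable (W : ∀ (a : P) (K : ℕ), WindowScheduleModWin r (w a K)) (hκ : 0 ≤ κ)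
variable {Fn : ∀ (a : P) (K : ℕ), (𝒯.B a K).Birth → ℕ → ℕ → Fld d R → ℂ}
  {rel : ∀ (a : P) (K : ℕ), (𝒯.B a K).Birth → ℕ → ℕ → Fld d R → Fld d R → Prop}
  {ref : ∀ (a : P) (K : ℕ), (𝒯.B a K).Birth → ℕ → Fld d R → Fld d R}
  {base : ∀ (a : P) (K : ℕ), (𝒯.B a K).Birth → ℕ → Fld d R → ℝ}
  {𝒜 𝒬 : ∀ (a : P) (K : ℕ), (𝒯.B a K).Birth → ℕ → Fld d R → Fld d R → ℂ}
  {q : ∀ (a : P) (K : ℕ), (𝒯.B a K).Birth → ℕ → Fld d R → ℂ}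
  {μ : ∀ (a : P) (K : ℕ), (𝒯.B a K).Birth → ℕ → Measure (Fld d R)}
  {z₀ z₁ : ∀ (a : P) (K : ℕ), (𝒯.B a K).Birth → ℕ → Fld d R}
  {defect : ∀ (a : P) (K : ℕ), (𝒯.B a K).Birth → ℕ → ℕ → ℝ}
  {s s1 : ∀ (a : P) (K : ℕ), (𝒯.B a K).Birth → ℕ → ℝ}
  {Asz : ∀ (a : P) (K : ℕ), (𝒯.B a K).Birth → ℕ → ℕ → ℝ}
  {S : ∀ (a : P) (K : ℕ), ℕ → (𝒯.B a K).Birth → Finset (𝒯.B a K).Birth}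
  {Sg : ∀ (a : P) (K : ℕ), ℕ → (𝒯.B a K).Birth → Finset ((𝒯.B a K).Birth × ℕ)}
  {c : ∀ (a : P) (K : ℕ), (𝒯.B a K).Birth → ℕ → ℂ}
  {δf : ∀ (a : P) (K : ℕ), (𝒯.B a K).Birth → ℕ → (𝒯.B a K).Birth × ℕ → ℝ}
  {creg : ∀ (_ : P) (_ : ℕ), ℕ → ℝ}
-- DATA replacing the structural leaves: anchoring + met-component housing (L-C, as in S3k), the ℝ-step (L-B, this file)
variable {Lb mB v vR : ℕ} (Anch : ∀ (a : P) (K : ℕ), Anchoring (𝒯.B a K) 4 Lb)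
  {comp : ∀ (a : P) (K : ℕ), ℕ → (𝒯.B a K).Birth → Finset (𝒯.B a K).Cube}
  (Rs : ∀ (a : P) (K : ℕ), RStep (𝒯.B a K))
  {β : ∀ (_ : P) (_ : ℕ), ℕ → ℝ} {A β₀ : ℝ}

-- the ratio family (K-free κ)
variable (hratio : ∀ (a : P) (K : ℕ), ∀ k, 2 * (W a K).σ k ≤ κ * (W a K).ϱc k)
-- row S3's located scalars ((w7) largeness, (w6) window) and signs — ONCE
variable (hL : 1 ≤ L)
variable (hcbar : 0 ≤ cbar)
variable (hN₀ : 0 ≤ N₀)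
variable (hA₀ : 0 ≤ A₀)
variable (hm : 0 ≤ m)
variable (hloc : locCell L (4 * cδ / r) cbar κ ≤ ρ')
variable (hρ'1 : ρ' < 1)
variable (hsmall : m * (N₀ * A₀ * (1 - ρ')⁻¹) ≤ 1 - sbar)
variable (hr : 0 < r)
variable (hcδ : 0 ≤ cδ)
-- the assembled END's estimate ∕ dictionary families (S3h-2 verbatim)
variable (hsl : ∀ (a : P) (K : ℕ), ∀ (b : (𝒯.B a K).Birth) (k' : ℕ), (𝒯.B a K).birthScale b ≤ k' → k' ≤ (𝒯.B a K).K →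
  RanBelow (budgetGate (𝒯.T a K) (s a K) m (S a K) (4 * cδ / r) (fun i => (L ^ 2)⁻¹ * (fun _ : ℕ => alphaCell κ) i)) k' →
  BirthSlice ((Fn a K) b k' k') latMove latN (bondBall d ((W a K).ρw k') : Set (Fld d R)) ((W a K).wc k') r ((𝒯.T a K).gen b k'))
variable (hFn : ∀ (a : P) (K : ℕ), ∀ (b : (𝒯.B a K).Birth) (k' k : ℕ), (𝒯.B a K).birthScale b ≤ k' → k' ≤ k →
  k + 1 ≤ (𝒯.B a K).K →
  RanBelow (budgetGate (𝒯.T a K) (s a K) m (S a K) (4 * cδ / r) (fun i => (L ^ 2)⁻¹ * (fun _ : ℕ => alphaCell κ) i)) (k + 1) →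
  ∀ U, (Fn a K) b k' (k + 1) U =
    wOp (expWeight ((base a K) b k) ((𝒜 a K) b k + (𝒬 a K) b k)) ((μ a K) b k) ((z₀ a K) b k) U (fun z => (Fn a K) b k' k (U + z)))
variable (h𝒢 : ∀ (a : P) (K : ℕ), ∀ (b : (𝒯.B a K).Birth) (k' k : ℕ), (𝒯.B a K).birthScale b ≤ k' → k' ≤ k →
  k + 1 ≤ (𝒯.B a K).K →
  RanBelow (budgetGate (𝒯.T a K) (s a K) m (S a K) (4 * cδ / r) (fun i => (L ^ 2)⁻¹ * (fun _ : ℕ => alphaCell κ) i)) (k + 1) →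
  ∀ U, (fun z => (Fn a K) b k' k (U + z)) ∈ BddClass ℂ ((μ a K) b k))
variable (hB : ∀ (a : P) (K : ℕ), ∀ (b : (𝒯.B a K).Birth) (k' k : ℕ), (𝒯.B a K).birthScale b ≤ k' → k' ≤ k →
  k + 1 ≤ (𝒯.B a K).K →
  RanBelow (budgetGate (𝒯.T a K) (s a K) m (S a K) (4 * cδ / r) (fun i => (L ^ 2)⁻¹ * (fun _ : ℕ => alphaCell κ) i)) (k + 1) →
  RealBaseAt ((ref a K) b k) ((base a K) b k) ((𝒜 a K) b k) ((μ a K) b k) (bondBall d ((W a K).ρw (k + 1)) : Set (Fld d R)))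
variable (hE : ∀ (a : P) (K : ℕ), ∀ (b : (𝒯.B a K).Birth) (k' k : ℕ), (𝒯.B a K).birthScale b ≤ k' → k' ≤ k →
  k + 1 ≤ (𝒯.B a K).K →
  RanBelow (budgetGate (𝒯.T a K) (s a K) m (S a K) (4 * cδ / r) (fun i => (L ^ 2)⁻¹ * (fun _ : ℕ => alphaCell κ) i)) (k + 1) →
  ExponentSliceAt ((ref a K) b k) ((𝒜 a K) b k) ((μ a K) b k) latMove latN (bondBall d ((W a K).ρw (k + 1)) : Set (Fld d R))
    ((W a K).wc (k + 1)) ((W a K).ϱc k) ((s a K) b k))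
variable (hQ : ∀ (a : P) (K : ℕ), ∀ b k, (fun U z => (𝒬 a K) b k U z - (q a K) b k U) =
  fun U z => (c a K) b k * ∑ x ∈ (Sg a K) k b, ((Fn a K) x.1 x.2 k (U + z) - (Fn a K) x.1 x.2 k (U + (z₁ a K) b k)))
variable (hSg : ∀ (a : P) (K : ℕ), ∀ k b, ∀ x ∈ (Sg a K) k b, x.1 ∈ (S a K) k b ∧ (𝒯.B a K).birthScale x.1 ≤ x.2 ∧ x.2 ≤ k)
variable (hs1 : ∀ (a : P) (K : ℕ), ∀ b k, (s1 a K) b k = ‖(c a K) b k‖ * ∑ x ∈ (Sg a K) k b,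
  (4 / r * stepProd (fun _ : ℕ => alphaCell κ) x.2 k * (𝒯.T a K).gen x.1 x.2) * (δf a K) b k x)
variable (hAsz_birth : ∀ (a : P) (K : ℕ), ∀ f k'', (Asz a K) f k'' k'' = (𝒯.T a K).gen f k'')
variable (hAsz_step : ∀ (a : P) (K : ℕ), ∀ f k'' k, (𝒯.B a K).birthScale f ≤ k'' → k'' ≤ k →
  (Asz a K) f k'' (k + 1) = Real.exp (3 * ((s a K) f k + (s1 a K) f k)) * (Asz a K) f k'' k)
variable (hδf : ∀ (a : P) (K : ℕ), ∀ b k, ∀ x ∈ (Sg a K) k b, 0 ≤ (δf a K) b k x ∧ (δf a K) b k x ≤ cδ * ((L ^ 2)⁻¹) ^ (k - x.2))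
variable (hDμ : ∀ (a : P) (K : ℕ), ∀ b k, ∀ᵐ z ∂(μ a K) b k, z ∈ (bondBall d ((W a K).σ k) : Set (Fld d R)))
variable (hz₁ : ∀ (a : P) (K : ℕ), ∀ b k, (z₁ a K) b k ∈ (bondBall d ((W a K).σ k) : Set (Fld d R)))
variable (hpairx : ∀ (a : P) (K : ℕ), ∀ (b : (𝒯.B a K).Birth) (k' k : ℕ), (𝒯.B a K).birthScale b ≤ k' → k' ≤ k →
  ∀ x ∈ (Sg a K) k b, ∀ U₀ ∈ (bondBall d ((W a K).ρw (k + 1)) : Set (Fld d R)), ∀ pd : NDir d R, 0 < latN pd →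
    latN pd ≤ (W a K).wc (k + 1) →
    ∀ᵐ z ∂(μ a K) b k, ∀ t ∈ tube ((W a K).ϱ₁ k / latN pd),
      RelGauge ((rel a K) x.1 x.2 k) latMove latN (latMove U₀ pd t + (z₁ a K) b k) (latMove U₀ pd t + z) ((δf a K) b k x))
variable (hinv : ∀ (a : P) (K : ℕ), ∀ b k' k, GaugeInvariant ((rel a K) b k' k) ((Fn a K) b k' k))
variable (hmeas : ∀ (a : P) (K : ℕ), ∀ (b f : (𝒯.B a K).Birth) (k'' k : ℕ) (U : Fld d R),
  AEStronglyMeasurable (fun z => (Fn a K) f k'' k (U + z)) ((μ a K) b k))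
variable (hdefwk : ∀ (a : P) (K : ℕ), ∀ (b : (𝒯.B a K).Birth) (k' k : ℕ), (defect a K) b k' k ≤ (W a K).wc k)
variable (hrate : ∀ (a : P) (K : ℕ), ∀ (b : (𝒯.B a K).Birth) (k' k : ℕ), (𝒯.B a K).birthScale b ≤ k' → k' ≤ k → k ≤ (𝒯.B a K).K →
  (defect a K) b k' k ≤ cδ * ((L ^ 2)⁻¹) ^ (k - k'))
-- F-8 REPLACED BY THE BOOKING CONVENTION (row S8): admissible pairs exist, booked size ≤ sup of realised increments
variable (hne : ∀ (a : P) (K : ℕ), ∀ (b : (𝒯.B a K).Birth) (k' k : ℕ), (𝒯.B a K).birthScale b ≤ k' → k' ≤ k → k ≤ (𝒯.B a K).K →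
  RanBelow (budgetGate (𝒯.T a K) (s a K) m (S a K) (4 * cδ / r) (fun i => (L ^ 2)⁻¹ * (fun _ : ℕ => alphaCell κ) i)) k →
  ∃ U₀ ∈ (bondBall d ((W a K).ρw k) : Set (Fld d R)), ∃ U₁ : Fld d R,
  RelGauge ((rel a K) b k' k) latMove latN U₀ U₁ ((defect a K) b k' k))
variable (hsup : ∀ (a : P) (K : ℕ), ∀ (b : (𝒯.B a K).Birth) (k' k : ℕ), (𝒯.B a K).birthScale b ≤ k' → k' ≤ k → k ≤ (𝒯.B a K).K →
  RanBelow (budgetGate (𝒯.T a K) (s a K) m (S a K) (4 * cδ / r) (fun i => (L ^ 2)⁻¹ * (fun _ : ℕ => alphaCell κ) i)) k →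
  (𝒯.T a K).lin b k' k ≤ sSup {x : ℝ | ∃ U₀ ∈ (bondBall d ((W a K).ρw k) : Set (Fld d R)), ∃ U₁ : Fld d R,
    RelGauge ((rel a K) b k' k) latMove latN U₀ U₁ ((defect a K) b k' k) ∧ x = ‖(Fn a K) b k' k U₁ - (Fn a K) b k' k U₀‖})
-- the booking-level wall binders: (w5) regeneration, (w2-act) margin
variable (hc0 : ∀ (a : P) (K : ℕ), ∀ k, 0 ≤ (creg a K) k)
variable (hcb : ∀ (a : P) (K : ℕ), ∀ k, k < (𝒯.B a K).K → (creg a K) k ≤ cbar)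
variable (hreg : ∀ (a : P) (K : ℕ), (𝒯.T a K).RegeneratesFromVar (creg a K)
  (budgetGate (𝒯.T a K) (s a K) m (S a K) (4 * cδ / r) (fun _ : ℕ => (L ^ 2)⁻¹ * alphaCell κ)))
variable (hs₀ : ∀ (a : P) (K : ℕ), ∀ b k, (s a K) b k ≤ sbar)
-- (w3-book) L-C REPLACED BY ANCHORING DATA (row S4): blocking integer, multiplicity, housing, component volume
variable (hLb : (Lb : ℝ) = L)
variable (hmult : ∀ (a : P) (K : ℕ), ∀ j (x : Fin 4 → ℕ),
  ((𝒯.B a K).births.filter fun b => (𝒯.B a K).birthScale b = j ∧ x ∈ (Anch a K).dom b).card ≤ mB)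
variable (hscale : ∀ (a : P) (K : ℕ), ∀ k b, ∀ q ∈ (comp a K) k b, (𝒯.B a K).cubeScale q = k)
variable (hhoused : ∀ (a : P) (K : ℕ), ∀ k b, ∀ f ∈ (S a K) k b, ∃ q ∈ (comp a K) k b, f ∈ (𝒯.B a K).feltAt q)
variable (hvol : ∀ (a : P) (K : ℕ), ∀ k b, ((comp a K) k b).card ≤ v)
-- (w1)+(w5b) L-B REPLACED BY THE ℝ-STEP SEAM (rows S5 §3 ∕ S5e): component volume, pre-ℝ sizes below the transported envelope
-- under the dressed history, the absorption law («budgets add»), dressing sizes; the fan-out pair sits in the theorem headers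
variable (hcv : ∀ (a : P) (K : ℕ), (Rs a K).CompVol vR)
variable (hpre : ∀ (a : P) (K : ℕ), (𝒯.T a K).PreBelowEnv (Rs a K) (4 * cδ / r) (fun _ : ℕ => (L ^ 2)⁻¹ * alphaCell κ)
  (budgetGate (𝒯.T a K) (s a K) m (S a K) (4 * cδ / r) (fun _ : ℕ => (L ^ 2)⁻¹ * alphaCell κ)))
variable (hlaw : ∀ (a : P) (K : ℕ), (𝒯.T a K).AbsorbLaw (Rs a K) (4 * cδ / r) (β a K) A)
variable (hβ : ∀ (a : P) (K : ℕ), ∀ j, j ≤ (𝒯.B a K).K → (β a K) j ≤ β₀ * (L⁻¹ ^ 3) ^ ((𝒯.B a K).K - j))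

include W hκ Anch Rs hratio hL hcbar hN₀ hA₀ hm hloc hρ'1 hsmall hr hcδ hsl hFn h𝒢 hB hE hQ hSg hs1 hAsz_birth hAsz_step hδf
  hDμ hz₁ hpairx hinv hmeas hdefwk hrate hne hsup hc0 hcb hreg hs₀ hLb hmult hscale hhoused hvol hcv hpre hlaw hβ

/-! ## §2 END-ALL-slice-win ∘ suppliers through the ℝ-step seam: the row root (both forms) and ROOT-B -/

/-- **END-ALL-slice-win ∘ SUPPLIERS THROUGH THE ℝ-STEP SEAM — THE ROW ROOT WITH ITS CONSTANTS DISPLAYED** [bookkeeping]: S3h-2's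
`dressedStabilityWith_swin_of_schedules` BY NAME with F-8 `hlin` from the booking convention (`hlin_budgetGate_of_lin_le_sSup`), L-C
`hS`∕`hcount` from the anchoring (`count_of_anchoring_cell`), and L-B `hbirth` from the ℝ-step `Rs a K` at the cell's constants
(`hbirth_of_rstep_cell`: absorbed families counted through `RStep.absorbs_felt` + `CompVol vR` + the anchoring; absorption by `PreBelowEnv`
+ `AbsorbLaw`).  The scalars (`κ L c̄ N₀ A₀ s̄⁰ ρ′ r c_δ m v vR mB A β₀`) precede `∀ a K`.  NOT «NE1′ proved»: every wall binder displayed;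
0 instantiated on Bałaban's densities. [folklore] -/
theorem dressedStabilityWith_of_rstepSliceWinSchedules
    -- the two binders PARTICULAR to the assembled slice-window face, displayed in the header (cutoff-free source tie, per-step slice guard)
    (hcm : ∀ (a : P) (K : ℕ), ∀ b k, ‖(c a K) b k‖ ≤ m)
    (hδfwk : ∀ (a : P) (K : ℕ), ∀ b k, ∀ x ∈ (Sg a K) k b, (δf a K) b k x ≤ (W a K).wc k)
    (hvN₀ : (v : ℝ) * mB ≤ N₀) (hA : 0 ≤ A)
    (hfan : fanout A ((vR : ℝ) * mB) ρ' < 1) (hamp : absorbAmplitude β₀ A ((vR : ℝ) * mB) ρ' ≤ A₀) :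
    DressedStabilityWith 𝒯 A₀ (rhoOne (L ^ 2)⁻¹ (4 * cδ / r) cbar κ) (L⁻¹ ^ 3) :=
  dressedStabilityWith_swin_of_schedules 𝒯 W hratio hL hcbar hκ hN₀ hA₀ hm hloc hρ'1 hsmall hr hcδ hsl hFn h𝒢 hB hE hQ hSg hs1
    hAsz_birth hAsz_step hcm hδf hδfwk hDμ hz₁ hpairx hinv hmeas hdefwk hrate
    (fun a K => hlin_budgetGate_of_lin_le_sSup (T := 𝒯.T a K) (hne a K) (hsup a K))
    hc0 hcb hreg hs₀
    (fun a K => (count_of_anchoring_cell (Anch a K) hLb hL (hmult a K) (hscale a K) (hhoused a K) (hvol a K) hvN₀).1)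
    (fun a K => (count_of_anchoring_cell (Anch a K) hLb hL (hmult a K) (hscale a K) (hhoused a K) (hvol a K) hvN₀).2)
    (fun a K =>
      hbirth_of_rstep_cell hL (div_nonneg (mul_nonneg (by norm_num) hcδ) hr.le) hcbar hκ hN₀ hA₀ hm hloc hρ'1 hsmall (𝒯.T a K)
        (Rs a K) (fun _ : ℕ => (L ^ 2)⁻¹ * alphaCell κ) (s a K) (S a K) (Anch a K) hLb (hmult a K) (hcv a K) hA (hpre a K)
        (hlaw a K) (hβ a K) hfan hamp)

/-- **END-ALL-slice-win ∘ SUPPLIERS THROUGH THE ℝ-STEP SEAM — THE ROW ROOT `DressedStability 𝒯` LITERALLY** [bookkeeping]. [folklore] -/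
theorem dressedStability_of_rstepSliceWinSchedules
    -- the two binders PARTICULAR to the assembled slice-window face, displayed in the header (cutoff-free source tie, per-step slice guard)
    (hcm : ∀ (a : P) (K : ℕ), ∀ b k, ‖(c a K) b k‖ ≤ m)
    (hδfwk : ∀ (a : P) (K : ℕ), ∀ b k, ∀ x ∈ (Sg a K) k b, (δf a K) b k x ≤ (W a K).wc k)
    (hvN₀ : (v : ℝ) * mB ≤ N₀) (hA : 0 ≤ A)
    (hfan : fanout A ((vR : ℝ) * mB) ρ' < 1) (hamp : absorbAmplitude β₀ A ((vR : ℝ) * mB) ρ' ≤ A₀) :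
    DressedStability 𝒯 :=
  ⟨_, _, _, dressedStabilityWith_of_rstepSliceWinSchedules 𝒯 W hκ Anch Rs hratio hL hcbar hN₀ hA₀ hm hloc hρ'1 hsmall hr hcδ
    hsl hFn h𝒢 hB hE hQ hSg hs1 hAsz_birth hAsz_step hδf hDμ hz₁ hpairx hinv hmeas hdefwk hrate hne hsup hc0 hcb hreg
    hs₀ hLb hmult hscale hhoused hvol hcv hpre hlaw hβ hcm hδfwk hvN₀ hA hfan hamp⟩

/-- **… ⟹ ROOT-B `DressedBudget 𝒯 wt`** [bookkeeping]: nonnegative cube weights bounded by `w̄` and the bookings' positional counts read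
off the same anchoring (`positionalCount_of_anchoring_cell`, `mB ≤ v·mB ≤ N₀` from `1 ≤ v`) — S3h-2's `dressedBudget_swin_of_schedules` BY
NAME. [folklore] -/
theorem dressedBudget_of_rstepSliceWinSchedules
    -- the two binders PARTICULAR to the assembled slice-window face, displayed in the header (cutoff-free source tie, per-step slice guard)
    (hcm : ∀ (a : P) (K : ℕ), ∀ b k, ‖(c a K) b k‖ ≤ m)
    (hδfwk : ∀ (a : P) (K : ℕ), ∀ b k, ∀ x ∈ (Sg a K) k b, (δf a K) b k x ≤ (W a K).wc k)
    (hvN₀ : (v : ℝ) * mB ≤ N₀) (hA : 0 ≤ A)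
    (hfan : fanout A ((vR : ℝ) * mB) ρ' < 1) (hamp : absorbAmplitude β₀ A ((vR : ℝ) * mB) ρ' ≤ A₀)
    {wt : P → ℕ → ℕ → ℝ} {wbar : ℝ} (hwbar : 0 ≤ wbar)
    (hw0 : ∀ a K, ∀ j ≤ K, 0 ≤ wt a K j) (hwb : ∀ a K, ∀ j ≤ K, wt a K j ≤ wbar) (hv : 1 ≤ v) :
    DressedBudget 𝒯 wt :=
  have hmN₀ : (mB : ℝ) ≤ N₀ := by
    have h1 : (1 : ℝ) ≤ (v : ℝ) := by exact_mod_cast hv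
    have hmB : (0 : ℝ) ≤ (mB : ℝ) := by positivity
    nlinarith
  dressedBudget_swin_of_schedules 𝒯 W hratio hL hcbar hκ hN₀ hA₀ hm hloc hρ'1 hsmall hr hcδ hsl hFn h𝒢 hB hE hQ hSg hs1
    hAsz_birth hAsz_step hcm hδf hδfwk hDμ hz₁ hpairx hinv hmeas hdefwk hrate
    (fun a K => hlin_budgetGate_of_lin_le_sSup (T := 𝒯.T a K) (hne a K) (hsup a K))
    hc0 hcb hreg hs₀
    (fun a K => (count_of_anchoring_cell (Anch a K) hLb hL (hmult a K) (hscale a K) (hhoused a K) (hvol a K) hvN₀).1)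
    (fun a K => (count_of_anchoring_cell (Anch a K) hLb hL (hmult a K) (hscale a K) (hhoused a K) (hvol a K) hvN₀).2)
    (fun a K =>
      hbirth_of_rstep_cell hL (div_nonneg (mul_nonneg (by norm_num) hcδ) hr.le) hcbar hκ hN₀ hA₀ hm hloc hρ'1 hsmall (𝒯.T a K)
        (Rs a K) (fun _ : ℕ => (L ^ 2)⁻¹ * alphaCell κ) (s a K) (S a K) (Anch a K) hLb (hmult a K) (hcv a K) hA (hpre a K)
        (hlaw a K) (hβ a K) hfan hamp)
    hwbar hw0 hwb
    (fun a K => positionalCount_of_anchoring_cell (Anch a K) hLb hL (hmult a K) hmN₀)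

end EndAll

end Summit.QuantumFields.BalabanUV.T4Continuum.NE1p.DressedStabilityOfRStepSliceWinSchedules

end
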